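/-
Copyright (c) 2026. All rights reserved.
Released under Apache 2.0 license as described in the file LICENSE.
Authors: HodgeCM publication cell (pub-hodgecm), GR lane, seat GR-1 (`pub-hodgecm-own-real34`).
-/
import Literature.NumberTheory.Weil1964.ArchMetaplecticSiegelValue
import Literature.NumberTheory.Weil1964.ArchMetaplecticLeviCover
import Literature.NumberTheory.Weil1964.ArchMetaplecticQuotientCharacter
import Literature.NumberTheory.Weil1964.ArchSiegelLeviDual
import HarnessLib

/-!
# The value at the origin of an implementer of a Siegel element: the square of the unimodular part, WITH SIGN

Topic `NumberTheory/Weil1964`; namespace `Literature.NumberTheory.Weil1964.MpS`.  KERNEL only: proved theorems; no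
definition, no named fact, no `sorry`.  Sequel of `ArchMetaplecticSiegelValue` (`sq_originScalar_eq_quot`: for
`w = u · (levi a d · unip b) ∈ Mp^𝓢(W)` with `det a > 0`, `u² = quot w`), removing the positivity:

* **`quot_levi_eq_sign`** — `quot (levi a d) = sign(det a) = det a / |det a|` for EVERY dual Levi pair (`C(m(a,d)) = v > 0`,
  `det P(m(a,d)) = r det a`, `r > 0`, `|quot| = 1`; Folland's (4.24), (4.36), Thm. (4.37); the `det^{1/2}` cover of
  `GL_n(ℝ)`, [Adams2007, §5 Rem. 5.6]);
* **`sq_originScalar_mul_sign_eq_quot`** — `u² · sign(det a) = quot w` for `w = u · (levi a d · unip b)`;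
* `leviFactor_sq_eq_abs_det` (`(|det a|^{-1/2})² = |det d|`), `abs_det_eq_sign_mul_det` (`|det d| = sign(det a) det d`).

So the origin value `u |det a|^{-1/2}` of `w` has square `quot w · det d` — the formula used on the Siegel parabolic of
the doubled unitary group at the real places of `E` (`GelbartRogawski1991/DoubledWeilRepresentationArchLiftReps`).
Written for the stage-1 cell `pub-hodgecm` (GR lane); nothing here is a claim of the manuscripts adjudicated there.

## References

* G. B. Folland, *Harmonic Analysis in Phase Space*, Princeton UP 1989, §4.2 (4.24)–(4.25), (4.36), Thm. (4.37)
  [Folland1989].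
* J. Adams, *The theta correspondence over ℝ* (2007), §5 Rem. 5.6 [Adams2007].
-/

set_option autoImplicit false

noncomputable section

open scoped Matrix Classical
open Matrix Complex
open Literature.RepresentationTheory.HeisenbergGroup
open Literature.Analysis.SegalBargmann

namespace Literature.NumberTheory.Weil1964.MpS

variable {σ : Type*} [Fintype σ] [DecidableEq σ]

/-- **`quot (m(a, d)) = sign (det a) = det a / |det a|`** for an arbitrary dual Levi pair (`C(m(a,d)) = v > 0`,
`det P(m(a,d)) = r · det a` with `r > 0`, and `|quot| = 1`). [cite: Folland1989, §4.2 (4.24), Thm. (4.37)] -/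
theorem quot_levi_eq_sign (a d : (σ → ℝ) ≃ₗ[ℝ] (σ → ℝ)) (had : ∀ x y, dotPairing σ (a x) (d y) = dotPairing σ x y) :
    quot (levi a d had) =
      ((LinearMap.det (a : (σ → ℝ) →ₗ[ℝ] (σ → ℝ)) / |LinearMap.det (a : (σ → ℝ) →ₗ[ℝ] (σ → ℝ))| : ℝ) : ℂ) := by
  obtain ⟨v, hv, hvac⟩ := exists_pos_vac_levi a d had
  obtain ⟨r, hr, hdet⟩ := Sp.exists_pos_det_follandP_leviSp a d had
  set α : ℝ := LinearMap.det (a : (σ → ℝ) →ₗ[ℝ] (σ → ℝ)) with hα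
  have hα0 : α ≠ 0 := (LinearEquiv.isUnit_det' a).ne_zero
  have hq : quot (levi a d had) = (((v ^ 2 * r) * α : ℝ) : ℂ) := by
    rw [quot, hvac, proj_levi, hdet]
    push_cast
    ring
  have hn : |(v ^ 2 * r) * α| = 1 := by
    have h := norm_quot (levi a d had)
    rwa [hq, Complex.norm_real, Real.norm_eq_abs] at h
  have hpos : 0 < v ^ 2 * r := by positivity
  have hvr : v ^ 2 * r = 1 / |α| := by
    rw [abs_mul, abs_of_pos hpos] at hn
    rw [eq_div_iff (abs_ne_zero.2 hα0), hn]
  rw [hq, hvr, one_div, inv_mul_eq_div]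

/-- **the origin scalar squared, with sign**: if `w = u · (levi a d · unip b)` (`|u| = 1`) then
`u² · sign(det a) = quot w`. [cite: Folland1989, §4.2 (4.24)–(4.25), Thm. (4.37)] -/
theorem sq_originScalar_mul_sign_eq_quot {w : MpS σ} {a d : (σ → ℝ) ≃ₗ[ℝ] (σ → ℝ)}
    {had : ∀ x y, dotPairing σ (a x) (d y) = dotPairing σ x y}
    {b : (σ → ℝ) →ₗ[ℝ] (σ → ℝ)} {hb : ∀ x x', dotPairing σ x (b x') = dotPairing σ x' (b x)} {u : ℂ} {hu : ‖u‖ = 1}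
    (hw : w = unitScalar u hu * (levi a d had * unip b hb)) :
    u ^ 2 * ((LinearMap.det (a : (σ → ℝ) →ₗ[ℝ] (σ → ℝ)) / |LinearMap.det (a : (σ → ℝ) →ₗ[ℝ] (σ → ℝ))| : ℝ) : ℂ) =
      quot w := by
  rw [hw, quot_unitScalar_mul, quot_mul, quot_levi_eq_sign, quot_unip, mul_one]

omit [DecidableEq σ] in
/-- `(|det a|^{-1/2})² = |det d|` for a dual Levi pair (`det a · det d = 1`). [cite: Folland1989, §4.2 (4.24)] -/
theorem leviFactor_sq_eq_abs_det (a d : (σ → ℝ) ≃ₗ[ℝ] (σ → ℝ)) (had : ∀ x y, dotPairing σ (a x) (d y) = dotPairing σ x y) :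
    leviFactor a ^ 2 = ((|LinearMap.det (d : (σ → ℝ) →ₗ[ℝ] (σ → ℝ))| : ℝ) : ℂ) := by
  have h := det_mul_det_eq_one_of_dual a d had
  have ha : 0 < |LinearMap.det (a : (σ → ℝ) →ₗ[ℝ] (σ → ℝ))| := abs_pos.2 (LinearEquiv.isUnit_det' a).ne_zero
  have hda : |LinearMap.det (d : (σ → ℝ) →ₗ[ℝ] (σ → ℝ))| = |LinearMap.det (a : (σ → ℝ) →ₗ[ℝ] (σ → ℝ))|⁻¹ := by
    rw [← abs_inv]
    congr 1
    exact eq_inv_of_mul_eq_one_right h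
  rw [leviFactor, ← Complex.ofReal_pow]
  congr 1
  rw [← Real.rpow_natCast, ← Real.rpow_mul ha.le, hda, ← Real.rpow_neg_one]
  norm_num

omit [DecidableEq σ] in
/-- `|det d| = sign(det a) · det d` for a dual Levi pair (`det a`, `det d` have the same sign: `det a · det d = 1`).
[cite: Folland1989, §4.2 (4.24)] -/
theorem abs_det_eq_sign_mul_det (a d : (σ → ℝ) ≃ₗ[ℝ] (σ → ℝ))
    (had : ∀ x y, dotPairing σ (a x) (d y) = dotPairing σ x y) :
    |LinearMap.det (d : (σ → ℝ) →ₗ[ℝ] (σ → ℝ))| =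
      LinearMap.det (a : (σ → ℝ) →ₗ[ℝ] (σ → ℝ)) / |LinearMap.det (a : (σ → ℝ) →ₗ[ℝ] (σ → ℝ))| *
        LinearMap.det (d : (σ → ℝ) →ₗ[ℝ] (σ → ℝ)) := by
  set α : ℝ := LinearMap.det (a : (σ → ℝ) →ₗ[ℝ] (σ → ℝ))
  set β : ℝ := LinearMap.det (d : (σ → ℝ) →ₗ[ℝ] (σ → ℝ))
  have h : α * β = 1 := det_mul_det_eq_one_of_dual a d had
  have hα0 : α ≠ 0 := (LinearEquiv.isUnit_det' a).ne_zero
  rcases lt_or_gt_of_ne hα0 with hneg | hpos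
  · have hβ : β < 0 := by nlinarith
    rw [abs_of_neg hneg, abs_of_neg hβ, div_neg, div_self hα0]
    ring
  · have hβ : 0 < β := by nlinarith
    rw [abs_of_pos hpos, abs_of_pos hβ, div_self hα0, one_mul]

end Literature.NumberTheory.Weil1964.MpS

end
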